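import Summits.QuantumFields.BalabanUV.Beta.GAN24.Push4
import Summits.QuantumFields.BalabanUV.Beta.GAN24.TaylorBlockSum
import Literature.MathematicalPhysics.QuantumFieldTheory.Balaban1983to89.B4ContourShift

/-!
# `BalabanUV.Beta.GAN24.Push4LegMoves` — binder row G-an2-4 / (CONV-C), W-slot road «W3», ROW W3-F3a (T-marg) CORE (F3-core-a), PART 1:
# THE LEG-MOVING BRICKS OF THE FOUR-LEG MASS COUNT AND THE TWO TABLE-LEG LEVELS `u′`, `u` OF leaf-17's `push₄`

NOT IN PRINT; OUR PROOF ATTEMPT (G-an2-4 formalisation swarm, leaf prover `b2b-balaban-gan24-formalise-leaf-10`, gen 17; the row owner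
gan24-p1-g5's `SKELETON-W3.md` v1.0.2 §8.6 statement-level cut (F3-core-a), RULINGS-14 (R14-4) ∕ RULINGS-14c invitation «W3-TMARG*»,
journal INTENT l.8086; module name PROVISIONAL — the owner may rename ∕ re-cut).  HONEST FRAMING (cell contract, verbatim): «discharging
`BetaPertH` makes Bałaban's UV stability UNCONDITIONAL — a real constructive-QFT result; it is NOT the continuum limit and NOT the Clay
problem.»  HONEST DEPENDENCY (verbatim): «continuum YM on T⁴ ⇐ BetaPertH ∧ nine spine estimates (0/9 proved); BetaPertH ⇐ (D1) ∧ (D4) ∧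
CAP+tail; G-an2-4 gates asym, D1 and NE2/3/4.»

WHAT (PART 1 of `GAN24/Push4LocStencil`; the currency is leaf-17's `Push4.vertexW ∕ vertex2W ∕ push₄ l r X μ y ν y′` with leg families
`r μ z κ u` — coarse bond `(μ, z)` FIRST, fine bond `(κ, u)` — and leaf-12's `RespStepDecay` block envelopes read in the `ℓ¹` currency,
`|r μ z κ u| ≤ A·(L^{d+2})⁻¹·e^{−κ₁|quo L u − z|₁}`):
* §0 bricks — `e^{−κ₀‖x‖∞} ≤ e^{−κ₁|x|₁}` for `κ₁(d+1) ≤ κ₀` (`exp_supNorm_le_exp_l1`, twin of `T4GaugeActionRatePair.exp_sup_le_exp_l1` kept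
  local to spare the import), dominated `tsum`s (`abs_tsum_le_of_shift`: a shifted exponential majorant sums to `ExpKernelCalculus.Zl`), and **THE BLOCK COUNT** `abs_tsum_le_blockCount`: a fine family dominated by a root-plus-three-legs vertex AT THE
  BLOCK `quo L z` of its point sums to `K·L^{d+1}·Zl(κ/2)·e^{−(κ/6)·spread}` (leaf-04's `TaylorBlockSum.tsum_comp_quo` + `tsum_legs_le` BY NAME);
* §1 **MOVING A BLOCK LEG BETWEEN FINE POINTS** costs `|w − u|₁ + (d+1)` in the exponent, `L`-free (`l1_quo_move`, from
  `TaylorBlockSum.l1_quo_sub_quo_le` and `L ≥ 1`), whence the three exponent inequalities `exp_move₁∕₂∕₃` of the levels `u′`, `u`, `x` (one,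
  two, three legs moved; each time half of the remaining table rate pays for the move: `κ₁ ≤ δ/2`, `δ/4`, `δ/12`);
* §2 levels `u′` (**`abs_vertexW_le`**: the inner table leg against `LocStencil₂ X C δ`) and `u` (**`abs_vertex2W_le`**: the outer table leg) —
  after them both block legs sit at the kernel argument `x` and the table's `(x, z)`-localisation is halved.
PART 2 (`GAN24/Push4LocStencil`) does the two kernel-leg levels and assembles (F3-core-a) `push₄_locStencil₂`.  [folklore] analysis on
`ℤ^{d+1}`: cites nothing, mints no `def`, no `def … : Prop`, instantiates no wall binder, 0 sorry.  Asserts NO shape of Bałaban's tables;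
«T2Shape» ∕ «T2SupRate» OPEN; discharges NOTHING of (hW, hWall); NOT «W-slot closed», NEVER «G-an2-4 closed»; NOT `BetaPertH`, NOT continuum,
NOT Clay.  Unit `b2b-balaban-gan24-formalise-leaf-10` (gen 17), 2026-08-20.
-/

noncomputable section

open Finset
open scoped BigOperators
open Literature.MathematicalPhysics.QuantumFieldTheory
open Literature.MathematicalPhysics.QuantumFieldTheory.Balaban1983to89
open Literature.MathematicalPhysics.QuantumFieldTheory.Balaban1983to89.Beta
open B12Sec2to5 (l1 l1_nonneg)
open B4ContourShift (supNorm abs_le_supNorm supNorm_nonneg)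
open ExpKernelCalculus (MKer BiLoc Zl Zl_pos summable_exp_shift summable_exp_shift' tsum_exp_shift tsum_exp_shift'
  l1_sub_triangle l1_sub_symm)
open OneStepResolventKernel (Fib wsum)
open BalabanCompositeJets (LocStencil₂)
open LatticeForm (quo)
open Summit.QuantumFields.BalabanUV.Beta.GAN24.Push4 (vertexW vertexW_apply vertex2W push₄ push₄_inl_inl isFF_push₄)
open Summit.QuantumFields.BalabanUV.Beta.GAN24.TaylorBlockSum (l1_quo_sub_quo_le tsum_comp_quo summable_comp_quo summable_legs
  tsum_legs_le nonneg_of_dominated)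

namespace Summit.QuantumFields.BalabanUV.Beta.GAN24.Push4LegMoves

variable {d : ℕ}

/-! ## §0 Elementary bricks -/

/-- [folklore] SUP-NORM DECAY IS `ℓ¹` DECAY AT ANY RATE `κ₁` WITH `κ₁(d+1) ≤ κ₀`: `e^{−κ₀‖x‖∞} ≤ e^{−κ₁|x|₁}` (since `|x|₁ ≤ (d+1)‖x‖∞`,
`T4GaugeActionRatePair.l1_le_mul_supNorm` ∕ `exp_sup_le_exp_l1` — re-derived in five lines to spare that import). -/
theorem exp_supNorm_le_exp_l1 {κ₀ κ₁ : ℝ} (hκ₁ : 0 ≤ κ₁) (hle : κ₁ * ((d : ℝ) + 1) ≤ κ₀) (x : Fin (d + 1) → ℤ) :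
    Real.exp (-(κ₀ * supNorm x)) ≤ Real.exp (-κ₁ * l1 x) := by
  rw [Real.exp_le_exp]
  have h : l1 x ≤ ((d : ℝ) + 1) * supNorm x := by
    unfold l1
    calc ∑ μ, |((x μ : ℤ) : ℝ)| ≤ ∑ _μ : Fin (d + 1), supNorm x := Finset.sum_le_sum fun i _ => by
            have h := abs_le_supNorm x i
            rwa [Int.cast_abs] at h
      _ = ((d : ℝ) + 1) * supNorm x := by
            rw [Finset.sum_const, Finset.card_univ, Fintype.card_fin, nsmul_eq_mul]; push_cast; ring
  have h0 := supNorm_nonneg x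
  nlinarith

/-- [folklore] A SHIFTED EXPONENTIAL MAJORANT: `|f v| ≤ K·e^{−c|v − u|₁}` (`c > 0`) gives `|Σ'_v f v| ≤ K·Zl(c)` (dominated `tsum`,
`tsum_of_norm_bounded` + `ExpKernelCalculus.tsum_exp_shift'`). -/
theorem abs_tsum_le_of_shift {f : (Fin (d + 1) → ℤ) → ℝ} {K c : ℝ} (hc : 0 < c) (u : Fin (d + 1) → ℤ)
    (h : ∀ v, |f v| ≤ K * Real.exp (-c * l1 (v - u))) : |∑' v, f v| ≤ K * Zl (d + 1) c := by
  have hb := tsum_of_norm_bounded ((summable_exp_shift' hc u).mul_left K).hasSum (fun v => by rw [Real.norm_eq_abs]; exact h v)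
  rw [Real.norm_eq_abs] at hb
  refine hb.trans (le_of_eq ?_)
  rw [tsum_mul_left, tsum_exp_shift']

/-- [folklore] **THE BLOCK COUNT WITH A ROOT AND THREE LEGS**: a fine family dominated by
`K·e^{−κ((Σ_i |quo L z − p i|₁) + |quo L z − y|₁)}` (three endpoints `p : Fin 3 → _`, root `y`) has
`|Σ'_z f z| ≤ K · L^{d+1} · Zl(κ/2) · e^{−(κ/6)·Σ_i |p i − y|₁}` — each block contributes its `L^{d+1}` points (`tsum_comp_quo`), the coarse
vertex sum is `tsum_legs_le`. -/
theorem abs_tsum_le_blockCount {L : ℕ} [NeZero L] {f : (Fin (d + 1) → ℤ) → ℝ} {K κ : ℝ} (hK : 0 ≤ K) (hκ : 0 < κ)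
    (p : Fin 3 → Fin (d + 1) → ℤ) (y : Fin (d + 1) → ℤ)
    (h : ∀ z, |f z| ≤ K * Real.exp (-κ * ((∑ i, l1 (quo L z - p i)) + l1 (quo L z - y)))) :
    |∑' z, f z| ≤ K * (L : ℝ) ^ (d + 1) * Zl (d + 1) (κ / 2) * Real.exp (-(κ / 6) * ∑ i, l1 (p i - y)) := by
  have hs : (Finset.univ : Finset (Fin 3)).Nonempty := Finset.univ_nonempty
  have hg := summable_legs (D := d + 1) hκ Finset.univ hs p y
  have hmaj := (summable_comp_quo (N := L) hg).mul_left K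
  have hb := tsum_of_norm_bounded hmaj.hasSum (fun z => by rw [Real.norm_eq_abs]; exact h z)
  rw [Real.norm_eq_abs] at hb
  refine hb.trans ?_
  rw [tsum_mul_left, tsum_comp_quo (N := L) hg, mul_assoc K, mul_assoc K, mul_assoc ((L : ℝ) ^ (d + 1))]
  refine mul_le_mul_of_nonneg_left (mul_le_mul_of_nonneg_left ?_ (by positivity)) hK
  have h3 := tsum_legs_le (D := d + 1) hκ Finset.univ hs p y
  rw [Finset.card_univ, Fintype.card_fin] at h3
  refine h3.trans (le_of_eq ?_)
  norm_num

/-! ## §1 Moving a block-decaying leg between fine points -/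

section Core

variable {L : ℕ} [NeZero L]
  {l r : Fin (d + 1) → (Fin (d + 1) → ℤ) → Fin (d + 1) → (Fin (d + 1) → ℤ) → ℝ}
  {X : Fin (d + 1) → (Fin (d + 1) → ℤ) → Fin (d + 1) → (Fin (d + 1) → ℤ) → MKer (d + 1) (Fib d)}
  {A C δ κ₁ : ℝ}

/-- [folklore] **MOVING THE FINE POINT OF A BLOCK LEG** costs the fine distance plus `d+1`:
`|quo L u − p|₁ ≤ |quo L w − p|₁ + |w − u|₁ + (d+1)` (`quo` is `ℓ¹`-Lipschitz up to `d+1`, `TaylorBlockSum.l1_quo_sub_quo_le`, and `L ≥ 1`). -/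
theorem l1_quo_move (p w u : Fin (d + 1) → ℤ) :
    l1 (quo L u - p) ≤ l1 (quo L w - p) + l1 (w - u) + ((d : ℝ) + 1) := by
  have h1 : l1 (quo L u - p) ≤ l1 (quo L u - quo L w) + l1 (quo L w - p) := l1_sub_triangle _ _ _
  have h2 : l1 (quo L u - quo L w) ≤ l1 (u - w) / L + (d + 1 : ℕ) := l1_quo_sub_quo_le (N := L) u w
  have hL : (1 : ℝ) ≤ (L : ℝ) := by exact_mod_cast Nat.one_le_iff_ne_zero.mpr (NeZero.ne L)
  have h3 : l1 (u - w) / L ≤ l1 (u - w) := div_le_self (l1_nonneg _) hL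
  have h4 : l1 (u - w) = l1 (w - u) := l1_sub_symm _ _
  push_cast at h2
  linarith

/-- [folklore] LEVEL `u′` (one leg moved `u′ → u`, half of `δ` spent): for `0 ≤ κ₁ ≤ δ/2`,
`e^{−κ₁|quo L w − p|₁}·e^{−δ|w − u|₁} ≤ e^{κ₁(d+1)}·e^{−κ₁|quo L u − p|₁}·e^{−(δ/2)|w − u|₁}`. -/
theorem exp_move₁ (hκ₁ : 0 ≤ κ₁) (hκδ : κ₁ ≤ δ / 2) (p w u : Fin (d + 1) → ℤ) :
    Real.exp (-κ₁ * l1 (quo L w - p)) * Real.exp (-δ * l1 (w - u)) ≤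
      Real.exp (κ₁ * ((d : ℝ) + 1)) * Real.exp (-κ₁ * l1 (quo L u - p)) * Real.exp (-(δ / 2) * l1 (w - u)) := by
  rw [← Real.exp_add, ← Real.exp_add, ← Real.exp_add, Real.exp_le_exp]
  have h := mul_le_mul_of_nonneg_left (l1_quo_move (L := L) p w u) hκ₁
  have hb := mul_le_mul_of_nonneg_right hκδ (l1_nonneg (w - u))
  linarith

/-- [folklore] LEVEL `u` (two legs moved `u → x`, the `x`-leg halved, the triangle `|x − z|₁ ≤ |x − u|₁ + |u − z|₁`): for `0 ≤ κ₁ ≤ δ/4`,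
`e^{−κ₁|quo L u − y|₁}·e^{−κ₁|quo L u − y′|₁}·e^{−δ(|x−u|₁+|z−u|₁)} ≤ e^{2κ₁(d+1)}·e^{−κ₁(|quo L x − y|₁+|quo L x − y′|₁)}·e^{−(δ/2)|x−z|₁}·e^{−(δ/2)|u−z|₁}`. -/
theorem exp_move₂ (hκ₁ : 0 ≤ κ₁) (hκδ : κ₁ ≤ δ / 4) (y y' x z u : Fin (d + 1) → ℤ) :
    Real.exp (-κ₁ * l1 (quo L u - y)) * Real.exp (-κ₁ * l1 (quo L u - y')) * Real.exp (-δ * (l1 (x - u) + l1 (z - u))) ≤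
      Real.exp (2 * κ₁ * ((d : ℝ) + 1)) * Real.exp (-κ₁ * (l1 (quo L x - y) + l1 (quo L x - y'))) *
        Real.exp (-(δ / 2) * l1 (x - z)) * Real.exp (-(δ / 2) * l1 (u - z)) := by
  rw [← Real.exp_add, ← Real.exp_add, ← Real.exp_add, ← Real.exp_add, ← Real.exp_add, Real.exp_le_exp]
  have h1 := mul_le_mul_of_nonneg_left (l1_quo_move (L := L) y u x) hκ₁
  have h2 := mul_le_mul_of_nonneg_left (l1_quo_move (L := L) y' u x) hκ₁
  have h3 : l1 (x - z) ≤ l1 (x - u) + l1 (u - z) := l1_sub_triangle _ _ _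
  have h4 : l1 (u - z) = l1 (z - u) := l1_sub_symm _ _
  have h5 : l1 (u - x) = l1 (x - u) := l1_sub_symm _ _
  have hb := mul_le_mul_of_nonneg_right hκδ (l1_nonneg (x - u))
  have hδ4 : 0 ≤ δ / 4 := hκ₁.trans hκδ
  have hz := l1_nonneg (z - u)
  nlinarith

/-- [folklore] LEVEL `x` (three legs moved `x → z`, the `(x,z)`-leg halved again): for `0 ≤ κ₁ ≤ δ/12`,
`e^{−κ₁|quo L x − x′|₁}·e^{−κ₁(|quo L x − y|₁+|quo L x − y′|₁)}·e^{−(δ/2)|x−z|₁} ≤ e^{3κ₁(d+1)}·e^{−κ₁(|quo L z − x′|₁+|quo L z − y|₁+|quo L z − y′|₁)}·e^{−(δ/4)|x−z|₁}`. -/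
theorem exp_move₃ (hκ₁ : 0 ≤ κ₁) (hκδ : κ₁ ≤ δ / 12) (x' y y' x z : Fin (d + 1) → ℤ) :
    Real.exp (-κ₁ * l1 (quo L x - x')) * Real.exp (-κ₁ * (l1 (quo L x - y) + l1 (quo L x - y'))) *
        Real.exp (-(δ / 2) * l1 (x - z)) ≤
      Real.exp (3 * κ₁ * ((d : ℝ) + 1)) * Real.exp (-κ₁ * (l1 (quo L z - x') + l1 (quo L z - y) + l1 (quo L z - y'))) *
        Real.exp (-(δ / 4) * l1 (x - z)) := by
  rw [← Real.exp_add, ← Real.exp_add, ← Real.exp_add, ← Real.exp_add, Real.exp_le_exp]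
  have h1 := mul_le_mul_of_nonneg_left (l1_quo_move (L := L) x' x z) hκ₁
  have h2 := mul_le_mul_of_nonneg_left (l1_quo_move (L := L) y x z) hκ₁
  have h3 := mul_le_mul_of_nonneg_left (l1_quo_move (L := L) y' x z) hκ₁
  have hb := mul_le_mul_of_nonneg_right hκδ (l1_nonneg (x - z))
  linarith

/-! ## §2 The four levels of the push: `u′` (inner table leg), `u` (outer table leg), `x` (left kernel leg), `z` (right kernel leg) -/

/-- [folklore] **LEVEL `u′` — THE INNER TABLE LEG**: with the `ℓ¹` block envelope of `r` (rate `κ₁ ≤ δ/2`) and `LocStencil₂ X C δ`,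
`|vertexW r (X κ u) ν y′ x z a b| ≤ (d+1)·A·(L^{d+2})⁻¹·C·e^{κ₁(d+1)}·Zl(δ/2) · e^{−κ₁|quo L u − y′|₁} · e^{−δ(|x−u|₁+|z−u|₁)}`. -/
theorem abs_vertexW_le (hA : 0 ≤ A) (hδ : 0 < δ) (hκ₁ : 0 ≤ κ₁) (hκδ : κ₁ ≤ δ / 2)
    (hr₁ : ∀ μ z κ u, |r μ z κ u| ≤ A * ((L : ℝ) ^ (d + 2))⁻¹ * Real.exp (-κ₁ * l1 (quo L u - z)))
    (hX : LocStencil₂ X C δ)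
    (κ : Fin (d + 1)) (u : Fin (d + 1) → ℤ) (ν : Fin (d + 1)) (y' x z : Fin (d + 1) → ℤ) (a b : Fib d) :
    |vertexW r (X κ u) ν y' x z a b| ≤
      ((d : ℝ) + 1) * (A * ((L : ℝ) ^ (d + 2))⁻¹ * C * Real.exp (κ₁ * ((d : ℝ) + 1)) * Zl (d + 1) (δ / 2)) *
        Real.exp (-κ₁ * l1 (quo L u - y')) * Real.exp (-δ * (l1 (x - u) + l1 (z - u))) := by
  have hC : 0 ≤ C := hX.nonneg
  rw [vertexW_apply]
  refine (Finset.abs_sum_le_sum_abs _ _).trans ?_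
  have hpt : ∀ κ' : Fin (d + 1), |∑' u', r ν y' κ' u' * X κ u κ' u' x z a b| ≤
      (A * ((L : ℝ) ^ (d + 2))⁻¹ * C * Real.exp (κ₁ * ((d : ℝ) + 1)) * Real.exp (-κ₁ * l1 (quo L u - y')) *
        Real.exp (-δ * (l1 (x - u) + l1 (z - u)))) * Zl (d + 1) (δ / 2) := by
    intro κ'
    refine abs_tsum_le_of_shift (half_pos hδ) u fun u' => ?_
    rw [abs_mul]
    have h1 := hr₁ ν y' κ' u'
    have h2 : |X κ u κ' u' x z a b| ≤ C * Real.exp (-δ * l1 (u' - u)) * Real.exp (-δ * (l1 (x - u) + l1 (z - u))) :=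
      hX κ u κ' u' x z a b
    calc |r ν y' κ' u'| * |X κ u κ' u' x z a b|
        ≤ (A * ((L : ℝ) ^ (d + 2))⁻¹ * Real.exp (-κ₁ * l1 (quo L u' - y'))) *
            (C * Real.exp (-δ * l1 (u' - u)) * Real.exp (-δ * (l1 (x - u) + l1 (z - u)))) :=
          mul_le_mul h1 h2 (abs_nonneg _) (by positivity)
      _ = A * ((L : ℝ) ^ (d + 2))⁻¹ * C * Real.exp (-δ * (l1 (x - u) + l1 (z - u))) *
            (Real.exp (-κ₁ * l1 (quo L u' - y')) * Real.exp (-δ * l1 (u' - u))) := by ring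
      _ ≤ A * ((L : ℝ) ^ (d + 2))⁻¹ * C * Real.exp (-δ * (l1 (x - u) + l1 (z - u))) *
            (Real.exp (κ₁ * ((d : ℝ) + 1)) * Real.exp (-κ₁ * l1 (quo L u - y')) * Real.exp (-(δ / 2) * l1 (u' - u))) :=
          mul_le_mul_of_nonneg_left (exp_move₁ hκ₁ hκδ y' u' u) (by positivity)
      _ = _ := by ring
  calc ∑ κ' : Fin (d + 1), |∑' u', r ν y' κ' u' * X κ u κ' u' x z a b|
      ≤ ∑ _κ' : Fin (d + 1), (A * ((L : ℝ) ^ (d + 2))⁻¹ * C * Real.exp (κ₁ * ((d : ℝ) + 1)) *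
          Real.exp (-κ₁ * l1 (quo L u - y')) * Real.exp (-δ * (l1 (x - u) + l1 (z - u)))) * Zl (d + 1) (δ / 2) :=
        Finset.sum_le_sum fun κ' _ => hpt κ'
    _ = _ := by rw [Finset.sum_const, Finset.card_univ, Fintype.card_fin, nsmul_eq_mul]; push_cast; ring

/-- [folklore] **LEVEL `u` — THE OUTER TABLE LEG** (rate `κ₁ ≤ δ/4`):
`|vertex2W r X μ y ν y′ x z a b| ≤ B₂ · e^{−κ₁(|quo L x − y|₁ + |quo L x − y′|₁)} · e^{−(δ/2)|x − z|₁}` with the `L`-bookkeeping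
`B₂ = (d+1)·A·(L^{d+2})⁻¹·B₁·e^{2κ₁(d+1)}·Zl(δ/2)`, `B₁` the constant of `abs_vertexW_le` — both block legs now sit at `x`. -/
theorem abs_vertex2W_le (hA : 0 ≤ A) (hδ : 0 < δ) (hκ₁ : 0 ≤ κ₁) (hκδ : κ₁ ≤ δ / 4)
    (hr₁ : ∀ μ z κ u, |r μ z κ u| ≤ A * ((L : ℝ) ^ (d + 2))⁻¹ * Real.exp (-κ₁ * l1 (quo L u - z)))
    (hX : LocStencil₂ X C δ)
    (μ : Fin (d + 1)) (y : Fin (d + 1) → ℤ) (ν : Fin (d + 1)) (y' x z : Fin (d + 1) → ℤ) (a b : Fib d) :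
    |vertex2W r X μ y ν y' x z a b| ≤
      ((d : ℝ) + 1) * (A * ((L : ℝ) ^ (d + 2))⁻¹ *
          (((d : ℝ) + 1) * (A * ((L : ℝ) ^ (d + 2))⁻¹ * C * Real.exp (κ₁ * ((d : ℝ) + 1)) * Zl (d + 1) (δ / 2))) *
          Real.exp (2 * κ₁ * ((d : ℝ) + 1)) * Zl (d + 1) (δ / 2)) *
        Real.exp (-κ₁ * (l1 (quo L x - y) + l1 (quo L x - y'))) * Real.exp (-(δ / 2) * l1 (x - z)) := by
  have hC : 0 ≤ C := hX.nonneg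
  have hZ : 0 < Zl (d + 1) (δ / 2) := Zl_pos (half_pos hδ)
  have hκδ2 : κ₁ ≤ δ / 2 := hκδ.trans (by linarith [hδ.le])
  show |vertexW r (fun κ u => vertexW r (X κ u) ν y') μ y x z a b| ≤ _
  rw [vertexW_apply]
  refine (Finset.abs_sum_le_sum_abs _ _).trans ?_
  have hpt : ∀ κ : Fin (d + 1), |∑' u, r μ y κ u * vertexW r (X κ u) ν y' x z a b| ≤
      (A * ((L : ℝ) ^ (d + 2))⁻¹ *
          (((d : ℝ) + 1) * (A * ((L : ℝ) ^ (d + 2))⁻¹ * C * Real.exp (κ₁ * ((d : ℝ) + 1)) * Zl (d + 1) (δ / 2))) *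
          Real.exp (2 * κ₁ * ((d : ℝ) + 1)) * Real.exp (-κ₁ * (l1 (quo L x - y) + l1 (quo L x - y'))) *
          Real.exp (-(δ / 2) * l1 (x - z))) * Zl (d + 1) (δ / 2) := by
    intro κ
    refine abs_tsum_le_of_shift (half_pos hδ) z fun u => ?_
    rw [abs_mul]
    have h1 := hr₁ μ y κ u
    have h2 := abs_vertexW_le hA hδ hκ₁ hκδ2 hr₁ hX κ u ν y' x z a b
    calc |r μ y κ u| * |vertexW r (X κ u) ν y' x z a b|
        ≤ (A * ((L : ℝ) ^ (d + 2))⁻¹ * Real.exp (-κ₁ * l1 (quo L u - y))) *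
            (((d : ℝ) + 1) * (A * ((L : ℝ) ^ (d + 2))⁻¹ * C * Real.exp (κ₁ * ((d : ℝ) + 1)) * Zl (d + 1) (δ / 2)) *
              Real.exp (-κ₁ * l1 (quo L u - y')) * Real.exp (-δ * (l1 (x - u) + l1 (z - u)))) :=
          mul_le_mul h1 h2 (abs_nonneg _) (by positivity)
      _ = A * ((L : ℝ) ^ (d + 2))⁻¹ *
            (((d : ℝ) + 1) * (A * ((L : ℝ) ^ (d + 2))⁻¹ * C * Real.exp (κ₁ * ((d : ℝ) + 1)) * Zl (d + 1) (δ / 2))) *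
            (Real.exp (-κ₁ * l1 (quo L u - y)) * Real.exp (-κ₁ * l1 (quo L u - y')) *
              Real.exp (-δ * (l1 (x - u) + l1 (z - u)))) := by ring
      _ ≤ A * ((L : ℝ) ^ (d + 2))⁻¹ *
            (((d : ℝ) + 1) * (A * ((L : ℝ) ^ (d + 2))⁻¹ * C * Real.exp (κ₁ * ((d : ℝ) + 1)) * Zl (d + 1) (δ / 2))) *
            (Real.exp (2 * κ₁ * ((d : ℝ) + 1)) * Real.exp (-κ₁ * (l1 (quo L x - y) + l1 (quo L x - y'))) *
              Real.exp (-(δ / 2) * l1 (x - z)) * Real.exp (-(δ / 2) * l1 (u - z))) :=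
          mul_le_mul_of_nonneg_left (exp_move₂ hκ₁ hκδ y y' x z u) (by positivity)
      _ = _ := by ring
  calc ∑ κ : Fin (d + 1), |∑' u, r μ y κ u * vertexW r (X κ u) ν y' x z a b|
      ≤ ∑ _κ : Fin (d + 1), (A * ((L : ℝ) ^ (d + 2))⁻¹ *
          (((d : ℝ) + 1) * (A * ((L : ℝ) ^ (d + 2))⁻¹ * C * Real.exp (κ₁ * ((d : ℝ) + 1)) * Zl (d + 1) (δ / 2))) *
          Real.exp (2 * κ₁ * ((d : ℝ) + 1)) * Real.exp (-κ₁ * (l1 (quo L x - y) + l1 (quo L x - y'))) *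
          Real.exp (-(δ / 2) * l1 (x - z))) * Zl (d + 1) (δ / 2) :=
        Finset.sum_le_sum fun κ _ => hpt κ
    _ = _ := by rw [Finset.sum_const, Finset.card_univ, Fintype.card_fin, nsmul_eq_mul]; push_cast; ring

end Core

end Summit.QuantumFields.BalabanUV.Beta.GAN24.Push4LegMoves

end
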